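/-
Copyright (c) 2026. All rights reserved.
Released under Apache 2.0 license as described in the file LICENSE.
Authors: abc-iut cell, prover seat abc-iut-L6-t14 (wave 2).
-/
import Mathlib.Algebra.MvPolynomial.Funext
import Mathlib.RingTheory.DiscreteValuationRing.Basic
import Literature.RingTheory.HenselLemma.PositiveSlope
import HarnessLib

/-!
# [AbsTopII] Lemma 2.1 (positive slope version of Hensel's lemma): the polynomial special case, proved

S. Mochizuki, *Topics in Absolute Anabelian Geometry II: Decomposition Groups and Endomorphisms*,
J. Math. Sci. Univ. Tokyo 20 (2013) [MochizukiAbsTopII2013], §2, Lemma 2.1 p. 31 (manuscript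
pagination, lit key `paper:url-585b8d0ad0d9`): `k` a complete discretely valued field,
`A = 𝒪_k[[X₁,…,X_m]]`, `B = 𝒪_k[[Y₁,…,Y_n]]`, `φ : B → A`, `Yⱼ ↦ fⱼ(X)` a CONTINUOUS
`𝒪_k`-algebra homomorphism whose Jacobian has rank `n` generically; then there are `β₀ ∈ 𝒴(𝒪_k)`
and `r > 0` such that (for every finite `k'/k`) every `β' ≡ β₀ (mod 𝔪^r)` in `𝒴(𝒪_{k'})` lifts to
`𝒳(𝒪_{k'})`.  Cited by [IUTchI] p. 67 ("the method of proof of [AbsTopII], Lemma 2.1").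

The tree's first typing of the polynomial / `k' = k` special case,
`Literature.AnabelianGeometry.AbsoluteAnabelian.positiveSlopeHensel_polynomial`
(`AbsTopII/PositiveSlopeHensel.lean`), omitted the continuity of `φ` — i.e. `fⱼ(0) ∈ 𝔪_k` — and is
refuted as typed in `AbsTopII/PositiveSlopeHenselCounterexample.lean` (`f = X + 1` over `ℤ₂`).
This file PROVES the special case WITH that hypothesis (`positiveSlopeHensel_polynomial_of_
constantCoeff_mem`): for `O` a complete discrete valuation ring, `f₁,…,f_n ∈ O[X₁,…,X_m]` with
`fⱼ(0) ∈ 𝔪` and some `n × n` Jacobian minor `D = det(∂fⱼ/∂X_{S k})` a nonzero polynomial, there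
are `β₀ ∈ 𝔪ⁿ` and `r > 0` such that every `β' ≡ β₀ (mod 𝔪^r)` equals `f(x)` for some `x ∈ 𝔪^m`;
and the printed UNIFORMITY in the extension (`positiveSlopeHensel_polynomial_uniform`): the same
`β₀, r` work in every local `O`-algebra `O'` complete for its maximal ideal with local structure
map (e.g. `𝒪_{k'}`, `k'/k` finite), for `β' ≡ β₀ (mod π^r O')`. The engine is
`exists_eval_eq_of_sub_mem_det_sq`: over ANY `I`-adically complete ring, `β' - f(x₀) ∈ d²·I`
(`d` the numerical Jacobian minor at `x₀`, not assumed a unit) implies `β' = f(x)` with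
`x - x₀ ∈ d·I` supported on the chosen variables.

Proof (the printed Newton-iteration method, made quantitative): pick `x₀ ∈ 𝔪^m` with
`d := D(x₀) ≠ 0` (`𝔪` is infinite and `D ≠ 0`, Mathlib `MvPolynomial.funext_set`); write
`(d) = 𝔪^δ`, put `β₀ := f(x₀)`, `r := 2δ + 1`, so that `β' - β₀ ∈ d²·𝔪`; then apply the Taylor-form
Hensel lemma with non-unit Jacobian determinant (`Literature.RingTheory.HenselLemma.
exists_eval_det_smul_eq`) to the Taylor polynomials of the `fⱼ` at `x₀` along the `n` directions
`S`, whose linear-coefficient matrix is the numerical minor `(∂fⱼ/∂X_{S k})(x₀)` by the first-order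
Taylor formula (`coeff_single_bind₁_affine`). TODO(general form): power series `fⱼ` and the
uniformity in finite extensions `k'/k` of the printed lemma. No side is taken on anything in the
IUT corpus; this is a classical lemma of a refereed paper, kernel-checked.
-/

namespace Literature.AnabelianGeometry.AbsoluteAnabelian

open MvPolynomial IsLocalRing Literature.RingTheory.HenselLemma

section Aux

variable {R : Type*} [CommRing R] {σ : Type*}

/-- If `x ≡ x'` modulo `I` coordinatewise then `p(x) ≡ p(x')` modulo `I`. [folklore] -/
private theorem eval_sub_eval_mem (I : Ideal R) (p : MvPolynomial σ R) (x x' : σ → R)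
    (h : ∀ i, x i - x' i ∈ I) : eval x p - eval x' p ∈ I := by
  induction p using MvPolynomial.induction_on with
  | C c => simp
  | add p q hp hq =>
    rw [map_add, map_add, add_sub_add_comm]
    exact I.add_mem hp hq
  | mul_X p i hp =>
    rw [map_mul, map_mul, eval_X, eval_X]
    have : eval x p * x i - eval x' p * x' i =
        (eval x p - eval x' p) * x i + eval x' p * (x i - x' i) := by ring
    rw [this]
    exact I.add_mem (I.mul_mem_right _ hp) (I.mul_mem_left _ (h i))

/-- `p(x) ∈ I` when all `x i ∈ I` and `p(0) ∈ I`. [folklore] -/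
private theorem eval_mem_of_constantCoeff_mem (I : Ideal R) (p : MvPolynomial σ R) (x : σ → R)
    (hx : ∀ i, x i ∈ I) (hp : constantCoeff p ∈ I) : eval x p ∈ I := by
  have h := eval_sub_eval_mem I p x 0 (fun i => by rw [Pi.zero_apply, sub_zero]; exact hx i)
  rw [eval_zero] at h
  have := I.add_mem h hp
  rwa [sub_add_cancel] at this

/-- The maximal ideal of a discrete valuation ring is infinite (it contains the distinct powers of
a uniformizer). [folklore] -/
private theorem maximalIdeal_infinite (O : Type*) [CommRing O] [IsDomain O]
    [IsDiscreteValuationRing O] : ((maximalIdeal O : Ideal O) : Set O).Infinite := by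
  obtain ⟨ϖ, hϖ⟩ := IsDiscreteValuationRing.exists_irreducible O
  have hmem : ϖ ∈ maximalIdeal O := by
    rw [hϖ.maximalIdeal_eq]; exact Ideal.mem_span_singleton_self ϖ
  refine Set.infinite_of_injective_forall_mem (f := fun k : ℕ => ϖ ^ (k + 1))
    (fun k l hkl => ?_) (fun k => ?_)
  · have := pow_injective_of_not_isUnit hϖ.not_isUnit hϖ.ne_zero hkl
    simpa using this
  · rw [pow_succ]
    exact Ideal.mul_mem_left _ _ hmem

end Aux

/-- **Newton–Hensel for a polynomial system along `n` chosen variables, non-unit Jacobian minor**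
(the "method of proof" of [AbsTopII] Lemma 2.1, over any adically complete ring): let `A` be
`I`-adically complete, `f₁,…,f_n ∈ A[X₁,…,X_m]`, `S : Fin n ↪ Fin m` a choice of `n` variables,
`x₀ ∈ A^m`, and `d := det (∂fⱼ/∂X_{S k})(x₀)` the numerical Jacobian minor at `x₀` (NOT assumed
to be a unit). Then every `β'` with `β'ⱼ - fⱼ(x₀) ∈ d²·I` is of the form `f(x)` with
`x - x₀ ∈ d·I` supported on the variables `S`. [cite: MochizukiAbsTopII2013, Lemma 2.1 p.31] -/
theorem exists_eval_eq_of_sub_mem_det_sq {A : Type*} [CommRing A] (I : Ideal A)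
    [IsAdicComplete I A] (m n : ℕ) (f : Fin n → MvPolynomial (Fin m) A) (S : Fin n ↪ Fin m)
    (x₀ : Fin m → A) (β' η : Fin n → A) (hη : ∀ j, η j ∈ I)
    (hβ' : ∀ j, β' j - MvPolynomial.eval x₀ (f j) =
      (Matrix.of fun j k : Fin n => MvPolynomial.eval x₀ (MvPolynomial.pderiv (S k) (f j))).det ^ 2
        * η j) :
    ∃ z : Fin n → A, (∀ k, z k ∈ I) ∧
      ∀ j, MvPolynomial.eval
        (fun i => x₀ i + if h : ∃ k, S k = i then
          (Matrix.of fun j k : Fin n =>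
            MvPolynomial.eval x₀ (MvPolynomial.pderiv (S k) (f j))).det * z h.choose else 0)
        (f j) = β' j := by
  classical
  set Jx : Matrix (Fin n) (Fin n) A := Matrix.of fun j k => eval x₀ (pderiv (S k) (f j)) with hJx
  set d : A := Jx.det with hd
  rcases isEmpty_or_nonempty (Fin n) with hn | hn
  · exact ⟨fun k => (IsEmpty.false k).elim, fun k => (IsEmpty.false k).elim,
      fun j => (IsEmpty.false j).elim⟩
  set t : Fin m → Fin n := Function.invFun S with ht
  have htS : ∀ k, t (S k) = k := Function.leftInverse_invFun S.injective
  set b : Fin m → A := fun i => if i ∈ Set.range S then 1 else 0 with hb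
  -- the Taylor polynomials of the `fⱼ` at `x₀` along `S`
  set T : Fin n → MvPolynomial (Fin n) A :=
    fun j => bind₁ (fun i => C (x₀ i) + C (b i) * X (t i)) (f j) with hT
  have hT0 : ∀ j, coeff 0 (T j) = eval x₀ (f j) := fun j => coeff_zero_bind₁_affine x₀ b t (f j)
  have hTlin : (Matrix.of fun j i : Fin n => coeff (Finsupp.single i 1) (T j)) = Jx := by
    ext j k
    simp only [Matrix.of_apply, hT, coeff_single_bind₁_affine, hJx]
    rw [Finset.sum_eq_single (S k)]
    · have hbk : b (S k) = 1 := by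
        simp only [hb]
        rw [if_pos ⟨k, rfl⟩]
      rw [hbk, one_mul]
    · intro i hi hne
      have hirange : i ∉ Set.range S := by
        rintro ⟨k', rfl⟩
        rw [Finset.mem_filter, htS] at hi
        exact hne (by rw [hi.2])
      have hbi : b i = 0 := by
        simp only [hb]
        rw [if_neg hirange]
      rw [hbi, zero_mul]
    · intro hk
      have hmem : S k ∈ Finset.univ.filter (fun i => t i = k) :=
        Finset.mem_filter.mpr ⟨Finset.mem_univ _, htS k⟩
      exact absurd hmem hk
  obtain ⟨z, hzI, hz⟩ := exists_eval_det_smul_eq (I := I) T η hη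
  rw [hTlin] at hz
  refine ⟨z, hzI, fun j => ?_⟩
  have h := hz j
  rw [hT, eval_bind₁_affine, hT0, ← hd, ← hβ' j, add_sub_cancel] at h
  have hfun : (fun i => x₀ i + b i * (d • z) (t i)) =
      fun i => x₀ i + if h : ∃ k, S k = i then d * z h.choose else 0 := by
    funext i
    rw [Pi.smul_apply, smul_eq_mul]
    congr 1
    by_cases hi : ∃ k, S k = i
    · have hbi : b i = 1 := by
        simp only [hb]
        rw [if_pos (Set.mem_range.mpr hi)]
      rw [dif_pos hi, hbi, one_mul]
      obtain ⟨k, rfl⟩ := hi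
      have hc : (⟨k, rfl⟩ : ∃ k', S k' = S k).choose = k :=
        S.injective (⟨k, rfl⟩ : ∃ k', S k' = S k).choose_spec
      rw [htS, hc]
    · have hbi : b i = 0 := by
        simp only [hb]
        rw [if_neg (fun h => hi (Set.mem_range.mp h))]
      rw [dif_neg hi, hbi, zero_mul]
  rw [hfun] at h
  exact h

-- `IsDiscreteValuationRing O` takes `[IsDomain O]` as a parameter, so both binders are needed;
-- the overlapping-instances linter's suggestion to drop one does not apply here.
set_option linter.overlappingInstances false in
/-- **[AbsTopII] Lemma 2.1 (Positive slope version of Hensel's lemma), polynomial special case,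
uniform in the extension**: let `O` be a discrete valuation ring (`= 𝒪_k`) with uniformizer `π`,
`f₁,…,f_n ∈ O[X₁,…,X_m]` with `fⱼ(0) ∈ 𝔪` (the printed continuity of `Yⱼ ↦ fⱼ`), and suppose some
`n × n` minor of the Jacobian is a nonzero polynomial. Then there are `β₀ ∈ 𝔪ⁿ` and `r > 0` such
that for EVERY local `O`-algebra `O'` complete for its maximal ideal and with local structure map
(e.g. `O' = 𝒪_{k'}` for a finite extension `k'/k`, p. 31: "for any finite extension field `k'` of
`k`"), every `β' ∈ O'ⁿ` with `β' ≡ β₀ (mod π^r O')` is `(fⱼ(x))ⱼ` for some `x ∈ 𝔪_{O'}^m`: "the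
image of `𝒳(𝒪_{k'}) → 𝒴(𝒪_{k'})` contains the ball `{β' | β' ≡ β₀ (mod π^r)}`". TODO(general
form): power series `fⱼ ∈ 𝒪_k[[X]]`. [cite: MochizukiAbsTopII2013, Lemma 2.1 p.31] -/
theorem positiveSlopeHensel_polynomial_uniform
    (O : Type*) [CommRing O] [IsDomain O] [IsDiscreteValuationRing O]
    (m n : ℕ) (f : Fin n → MvPolynomial (Fin m) O)
    (hf0 : ∀ j, constantCoeff (f j) ∈ maximalIdeal O)
    (hS : ∃ S : Fin n ↪ Fin m,
      (Matrix.of fun j k : Fin n => MvPolynomial.pderiv (S k) (f j)).det ≠ 0) :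
    ∃ (β₀ : Fin n → O) (r : ℕ), (∀ j, β₀ j ∈ maximalIdeal O) ∧ 0 < r ∧
      ∀ (O' : Type*) [CommRing O'] [IsLocalRing O'] [Algebra O O']
        [IsAdicComplete (maximalIdeal O') O'] [IsLocalHom (algebraMap O O')] (β' : Fin n → O'),
        (∀ j, β' j - algebraMap O O' (β₀ j) ∈ (maximalIdeal O ^ r).map (algebraMap O O')) →
          ∃ x : Fin m → O', (∀ i, x i ∈ maximalIdeal O') ∧
            ∀ j, MvPolynomial.eval x (MvPolynomial.map (algebraMap O O') (f j)) = β' j := by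
  classical
  obtain ⟨S, hD⟩ := hS
  set 𝔪 : Ideal O := maximalIdeal O
  -- Step 1: a point `x₀ ∈ 𝔪^m` where the Jacobian minor does not vanish (`𝔪` is infinite)
  set D : MvPolynomial (Fin m) O := (Matrix.of fun j k : Fin n => pderiv (S k) (f j)).det
    with hDdef
  have hx₀ : ∃ x₀ : Fin m → O, (∀ i, x₀ i ∈ 𝔪) ∧ eval x₀ D ≠ 0 := by
    by_contra hcon
    apply hD
    refine MvPolynomial.funext_set (fun _ => (𝔪 : Set O)) (fun _ => maximalIdeal_infinite O) ?_
    intro x hx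
    rw [Set.mem_univ_pi] at hx
    rw [map_zero]
    by_contra hne
    exact hcon ⟨x, hx, hne⟩
  obtain ⟨x₀, hx₀𝔪, hx₀D⟩ := hx₀
  -- the numerical minor at `x₀` and its determinant `d ≠ 0`
  set Jx : Matrix (Fin n) (Fin n) O := Matrix.of fun j k => eval x₀ (pderiv (S k) (f j)) with hJx
  set d : O := Jx.det with hd
  have hdD : d = eval x₀ D := by
    rw [hd, hDdef, RingHom.map_det, RingHom.mapMatrix_apply]
    rfl
  have hd0 : d ≠ 0 := hdD ▸ hx₀D
  -- Step 2: `(d) = 𝔪^δ`; the centre `β₀ := f(x₀)` and the exponent `r := 2δ + 1`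
  obtain ⟨ϖ, hϖ⟩ := IsDiscreteValuationRing.exists_irreducible O
  obtain ⟨δ, u, hu⟩ := IsDiscreteValuationRing.associated_pow_irreducible hd0 hϖ
  refine ⟨fun j => eval x₀ (f j), 2 * δ + 1, fun j => ?_, by omega, ?_⟩
  · exact eval_mem_of_constantCoeff_mem 𝔪 (f j) x₀ hx₀𝔪 (hf0 j)
  intro O' _ _ _ _ _ β' hβ'
  set φ : O →+* O' := algebraMap O O' with hφ
  have hϖ' : φ ϖ ∈ maximalIdeal O' := map_nonunit φ ϖ (by
    show ϖ ∈ maximalIdeal O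
    rw [hϖ.maximalIdeal_eq]; exact Ideal.mem_span_singleton_self ϖ)
  -- Step 3: base change of the data to `O'`
  set f' : Fin n → MvPolynomial (Fin m) O' := fun j => MvPolynomial.map φ (f j) with hf'
  set x₀' : Fin m → O' := fun i => φ (x₀ i) with hx₀'
  have heval : ∀ p : MvPolynomial (Fin m) O, eval x₀' (MvPolynomial.map φ p) = φ (eval x₀ p) := by
    intro p
    rw [eval_map, show eval x₀ p = eval₂ (RingHom.id O) x₀ p from rfl, eval₂_comp_left]
    rfl
  have hJx' : (Matrix.of fun j k : Fin n => eval x₀' (pderiv (S k) (f' j))) = φ.mapMatrix Jx := by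
    ext j k
    simp only [Matrix.of_apply, hf', pderiv_map, heval, RingHom.mapMatrix_apply, Matrix.map_apply,
      hJx]
  have hd' : (Matrix.of fun j k : Fin n => eval x₀' (pderiv (S k) (f' j))).det = φ d := by
    rw [hJx', hd, RingHom.map_det]
  -- `β' - β₀ = (φ d)² · η` with `η ∈ 𝔪'`
  have hη : ∀ j, ∃ η : O', η ∈ maximalIdeal O' ∧ β' j - eval x₀' (f' j) = φ d ^ 2 * η := by
    intro j
    have h := hβ' j
    have h𝔪pow : ((𝔪 ^ (2 * δ + 1)).map φ : Ideal O') = Ideal.span {φ ϖ ^ (2 * δ + 1)} := by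
      show (maximalIdeal O ^ _).map φ = _
      rw [hϖ.maximalIdeal_eq, Ideal.span_singleton_pow, Ideal.map_span, Set.image_singleton,
        map_pow]
    rw [h𝔪pow, Ideal.mem_span_singleton'] at h
    obtain ⟨c, hc⟩ := h
    refine ⟨c * φ ϖ * φ (u : O) ^ 2, (maximalIdeal O').mul_mem_right _
      ((maximalIdeal O').mul_mem_left _ hϖ'), ?_⟩
    rw [hf', heval, ← hc]
    have : φ ϖ ^ (2 * δ + 1) = (φ d * φ (u : O)) ^ 2 * φ ϖ := by
      rw [← map_mul, hu, map_pow]; ring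
    rw [this]; ring
  choose η hη𝔪 hηeq using hη
  -- Step 4: Newton–Hensel along the `n` directions `S`, in `O'`
  have hηeq' : ∀ j, β' j - eval x₀' (f' j) =
      (Matrix.of fun j k : Fin n => eval x₀' (pderiv (S k) (f' j))).det ^ 2 * η j := by
    intro j; rw [hd']; exact hηeq j
  obtain ⟨z, hz𝔪, hz⟩ :=
    exists_eval_eq_of_sub_mem_det_sq (maximalIdeal O') m n f' S x₀' β' η hη𝔪 hηeq'
  refine ⟨_, fun i => (maximalIdeal O').add_mem (map_nonunit φ _ (hx₀𝔪 i)) ?_, hz⟩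
  split_ifs with h
  · exact (maximalIdeal O').mul_mem_left _ (hz𝔪 _)
  · exact (maximalIdeal O').zero_mem

-- as above: both `[IsDomain O]` and `[IsDiscreteValuationRing O]` are needed.
set_option linter.overlappingInstances false in
/-- **[AbsTopII] Lemma 2.1 (Positive slope version of Hensel's lemma), polynomial / `k' = k`
special case, WITH the printed continuity hypothesis** `fⱼ(0) ∈ 𝔪` (the `fⱼ` are topologically
nilpotent, i.e. `Yⱼ ↦ fⱼ` is a continuous homomorphism `𝒪_k[[Y]] → 𝒪_k[[X]]`): let `O` be a
complete discrete valuation ring with maximal ideal `𝔪`, `f₁,…,f_n ∈ O[X₁,…,X_m]` with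
`fⱼ(0) ∈ 𝔪`, and suppose some `n × n` minor `det(∂fⱼ/∂X_{S(k)})` of the Jacobian is a nonzero
polynomial.  Then there exist `β₀ ∈ 𝔪ⁿ` and `r > 0` such that every `β' ∈ Oⁿ` with
`β' ≡ β₀ (mod 𝔪^r)` coordinatewise is of the form `(fⱼ(x))ⱼ` for some `x ∈ 𝔪^m`
("the image of `𝒳(𝒪_k) → 𝒴(𝒪_k)` contains the ball `{β' ≡ β₀ mod π^r}`", p. 31). This repairs
and proves the refuted typing `positiveSlopeHensel_polynomial` (see
`PositiveSlopeHenselCounterexample.lean`). [cite: MochizukiAbsTopII2013, Lemma 2.1 p.31] -/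
theorem positiveSlopeHensel_polynomial_of_constantCoeff_mem
    (O : Type*) [CommRing O] [IsDomain O] [IsDiscreteValuationRing O]
    [IsAdicComplete (maximalIdeal O) O] (m n : ℕ) (f : Fin n → MvPolynomial (Fin m) O)
    (hf0 : ∀ j, constantCoeff (f j) ∈ maximalIdeal O)
    (hS : ∃ S : Fin n ↪ Fin m,
      (Matrix.of fun j k : Fin n => MvPolynomial.pderiv (S k) (f j)).det ≠ 0) :
    ∃ (β₀ : Fin n → O) (r : ℕ), (∀ j, β₀ j ∈ maximalIdeal O) ∧ 0 < r ∧
      ∀ β' : Fin n → O, (∀ j, β' j - β₀ j ∈ maximalIdeal O ^ r) →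
        ∃ x : Fin m → O, (∀ i, x i ∈ maximalIdeal O) ∧ ∀ j, MvPolynomial.eval x (f j) = β' j := by
  obtain ⟨β₀, r, hβ₀, hr, h⟩ := positiveSlopeHensel_polynomial_uniform O m n f hf0 hS
  refine ⟨β₀, r, hβ₀, hr, fun β' hβ' => ?_⟩
  haveI : IsLocalHom (algebraMap O O) := isLocalHom_id O
  obtain ⟨x, hx, hfx⟩ := h O β' (fun j => by
    rw [Algebra.algebraMap_self, Ideal.map_id]; exact hβ' j)
  refine ⟨x, hx, fun j => ?_⟩
  have := hfx j
  rwa [Algebra.algebraMap_self, MvPolynomial.map_id] at this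

end Literature.AnabelianGeometry.AbsoluteAnabelian
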